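import Literature.NumberTheory.LFunctions.DegreeUniformTwistedZeroFreeRegion
import Literature.NumberTheory.LFunctions.ClassGroupLFunctionZeroFreeRegion
import Literature.NumberTheory.LFunctions.DedekindZetaZeroFreeRegionDegreeUniform
import HarnessLib

/-!
# The zero-free region for class group `L`-functions with an ABSOLUTE constant
# (Thorner–Zaman Theorem 3.1 / Lagarias–Odlyzko Lemma 8.1, uniformly in the field and its degree)

Topic `Literature/NumberTheory/LFunctions` (namespace `Literature.NumberTheory.LFunctions.NumberField`).
Everything in this file is PROVED (theorems only; no named facts).

`ClassGroupLFunctionZeroFreeRegion.lean` proves the zero-free region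
`σ > 1 − c/(log|d_K| + log(|t| + 4))` for the class group `L`-functions `L(s, χ)`, `χ ≠ 1`, of the
number fields `K` of a FIXED degree `n`, with `c = c(n)`.  Lagarias–Odlyzko [LO, Lemma 8.1] and
Thorner–Zaman [TZ, Theorem 3.1] have instead the region `σ > 1 − c/log(d_K (|t| + 3)^{n_K})` with
`c` ABSOLUTE, the degree entering only through the size `log d_K + n_K log(|t| + 3)`.  Here we
obtain this degree-uniform form from the size-functional engine
`DegreeUniformTwistedZeroFreeRegion.lean` with the size functional

  `𝓛(t) = M_K(t) = log|d_K| + 3 n_K + (n_K + 1) log(|t| + 7)`  (`discBound K t`),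

for which ALL the numeric parameters of the datum are absolute:
`η = 1`, `G = 1` (`|L₀(s, χ)| ≤ 2|d_K| e^{2n_K} (|t|+6)^{n_K+1} ≤ e^{M_K(t)}`,
`norm_classGroupLFunction₀_le`), `G' = 11` (`|L(1 + 1/32 + it, χ)| ≥ e^{−32 n_K} ≥ e^{−11 M_K(t)}`),
`K₀ = 77760` (Stark / Lagarias–Odlyzko: `Re(−ζ_K'/ζ_K)(σ) ≤ 1/(σ−1) + 77760 M_K(0)`,
`re_LSeries_vonMangoldtNorm_le`), `C₂ = 77761` (`Re(−L'/L)(s, ψ) ≤ 1 + 77760 M_K(t)`,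
`re_LSeries_twistVonMangoldt_le`).

Main results:

* (`M_K` is a size functional in the sense of `DegreeUniformTwistedZFRData`:
  `DedekindZetaZeroFreeRegionDegreeUniform.lean`;)
* `degreeUniformTwistedZFRData_classGroupLFunction₀_of_ne` / `_of_eq` — the data (`χ² ≠ 1`,
  `pole = false`; `χ² = 1 ≠ χ`, `pole = true`);
* `exists_zeroFree_classGroupLFunction₀_absolute` — **TZ Theorem 3.1 (zero-free region) for the
  class group characters `χ ≠ 1`, with an absolute constant**: there is `c > 0` such that for EVERY
  number field `K` (any degree), every class group character `χ ≠ 1` and every zero `ρ = β + iγ` of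
  `L₀(s, χ)` with `β > 1 − c/M_K(γ)`, `χ² = 1` and `γ = 0`; `exists_zeroFree_classGroupLFunction_absolute`
  — the same for `L(s, χ)` (`ρ ≠ 1`);
* (`discBound_le_seven_mul`, `DedekindZetaZeroFreeRegionDegreeUniform.lean`: `M_K(t) ≤ 7 log(Q (|t|+3)^{n_K})`,
  `Q = |d_K| n_K^{n_K}`, `n_K ≥ 2` — the region above contains Thorner–Zaman's
  `σ > 1 − (c/7)/log(Q(|t| + 3)^{n_K})`.)

(That there is at most one exceptional zero among ALL `χ` incl. `ζ_K`, and that it is simple — the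
remaining clauses of TZ Theorem 3.1 — is Landau–Page; `ζ_K` itself, with an absolute constant, is
`DedekindZetaZeroFreeRegionDegreeUniform.lean`.)

## References

* J. Thorner, A. Zaman, *A unified and improved Chebotarev density theorem*, Algebra & Number
  Theory 13 (2019), Theorem 3.1. [ThornerZaman2019]
* J. C. Lagarias, A. M. Odlyzko, *Effective versions of the Chebotarev density theorem* (1977),
  Lemmas 5.3, 5.6, 8.1. [LagariasOdlyzko1977]
* H. L. Montgomery, R. C. Vaughan, *Multiplicative Number Theory I*, CUP 2007, §11.1.
  [MontgomeryVaughan2007]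
-/

noncomputable section

open scoped NumberField nonZeroDivisors ComplexConjugate
open Complex Filter Topology Set Metric NumberField

namespace Literature.NumberTheory.LFunctions.NumberField

variable {K : Type*} [Field K] [NumberField K]

/-! ### The growth and the lower bound against `M_K` -/

/-- **`|L₀(s, χ)| ≤ e^{M_K(t)}` for `−1/2 ≤ σ ≤ 3`**, `χ ≠ 1`:
`2|d_K| e^{2n_K} (|t|+6)^{n_K+1} ≤ |d_K| e^{3n_K} (|t|+7)^{n_K+1}` (`2 ≤ e ≤ e^{n_K}`).
[folklore] -/
theorem norm_classGroupLFunction₀_le_exp_discBound {χ : ClassGroup (𝓞 K) →* ℂˣ} (hχ : χ ≠ 1)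
    {s : ℂ} (hs : -1 / 2 ≤ s.re) (hs3 : s.re ≤ 3) :
    ‖classGroupLFunction₀ K χ s‖ ≤ Real.exp (discBound K s.im) := by
  refine (norm_classGroupLFunction₀_le hχ hs hs3).trans ?_
  set n : ℕ := Module.finrank ℚ K with hn
  have hn1 : (1 : ℝ) ≤ n := by exact_mod_cast Module.finrank_pos (R := ℚ) (M := K)
  have hd : (0 : ℝ) < ((discr K).natAbs : ℝ) := by
    exact_mod_cast Int.natAbs_pos.mpr (discr_ne_zero K)
  have hτ : (0 : ℝ) < |s.im| + 6 := by positivity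
  unfold discBound
  rw [← hn, Real.exp_add, Real.exp_add, Real.exp_log hd,
    show ((n : ℝ) + 1) * Real.log (|s.im| + 7) = ((n + 1 : ℕ) : ℝ) * Real.log (|s.im| + 7) by
      push_cast; ring,
    Real.exp_nat_mul, Real.exp_log (by positivity)]
  have h1 : (|s.im| + 6) ^ (n + 1) ≤ (|s.im| + 7) ^ (n + 1) :=
    pow_le_pow_left₀ hτ.le (by linarith) _
  have h2 : 2 * Real.exp (2 * n) ≤ Real.exp (3 * n) := by
    have h3 : (2 : ℝ) ≤ Real.exp n := by
      have := Real.add_one_le_exp (n : ℝ)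
      linarith
    calc 2 * Real.exp (2 * n) ≤ Real.exp n * Real.exp (2 * n) :=
          mul_le_mul_of_nonneg_right h3 (Real.exp_pos _).le
      _ = Real.exp (3 * n) := by rw [← Real.exp_add]; ring_nf
  have h4 : 0 ≤ (|s.im| + 6) ^ (n + 1) := by positivity
  calc 2 * ((discr K).natAbs : ℝ) * Real.exp (2 * n) * (|s.im| + 6) ^ (n + 1)
      = ((discr K).natAbs : ℝ) * (2 * Real.exp (2 * n)) * (|s.im| + 6) ^ (n + 1) := by ring
    _ ≤ ((discr K).natAbs : ℝ) * Real.exp (3 * n) * (|s.im| + 7) ^ (n + 1) := by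
        gcongr
    _ = ((discr K).natAbs : ℝ) * Real.exp (3 * (n : ℝ)) * (|s.im| + 7) ^ (n + 1) := by norm_cast

/-- **`|L₀(1 + 1/32 + it, χ)| ≥ e^{−11 M_K(t)}`**, `χ ≠ 1`: `|L(s, χ)| ≥ ζ_K(σ)^{-1} ≥ e^{−n_K/(σ−1)}`
(`exp_neg_finrank_div_le_norm_classGroupLFunction`) and `32 n_K ≤ 11 · 3 n_K ≤ 11 M_K(t)`.
[folklore] -/
theorem exp_neg_discBound_le_norm_classGroupLFunction₀ {χ : ClassGroup (𝓞 K) →* ℂˣ} (hχ : χ ≠ 1)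
    (t : ℝ) :
    Real.exp (-(11 * discBound K t)) ≤ ‖classGroupLFunction₀ K χ (1 + 1 / 32 + t * I)‖ := by
  have hre : (1 + 1 / 32 + t * I : ℂ).re = 1 + 1 / 32 := by simp
  have hs1 : 1 < (1 + 1 / 32 + t * I : ℂ).re := by rw [hre]; norm_num
  have hne : (1 + 1 / 32 + t * I : ℂ) ≠ 1 := fun h ↦ by
    have := congrArg Complex.re h; rw [hre, one_re] at this; norm_num at this
  rw [classGroupLFunction₀_eq χ hne hχ]
  refine le_trans ?_ (exp_neg_finrank_div_le_norm_classGroupLFunction K χ hs1)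
  rw [Real.exp_le_exp, hre, show (1 : ℝ) + 1 / 32 - 1 = 1 / 32 by norm_num, neg_le_neg_iff]
  have := three_mul_finrank_le_discBound (K := K) t
  have h0 : (0 : ℝ) ≤ Module.finrank ℚ K := Nat.cast_nonneg _
  rw [div_eq_mul_inv, show ((1 : ℝ) / 32)⁻¹ = 32 by norm_num]
  nlinarith

/-! ### The datum -/

section Datum

/-- The fields of `DegreeUniformTwistedZFRData` shared by both cases, for `χ ≠ 1`, `𝓛 = M_K`,
`η = 1`, `G = 1`, `G' = 11`, `K₀ = 77760`. [folklore] -/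
theorem degreeUniformZFRData_common {χ : ClassGroup (𝓞 K) →* ℂˣ} (hχ : χ ≠ 1) :
    (∀ σ : ℝ, 1 < σ → σ ≤ 2 →
      (LSeries (fun m ↦ (vonMangoldtNorm K m : ℂ)) σ).re ≤ 1 / (σ - 1) + 77760 * discBound K 0) ∧
    (∀ s : ℂ, 1 - (1 : ℝ) < s.re → s.re ≤ 3 →
      ‖classGroupLFunction₀ K χ s‖ ≤ Real.exp (1 * discBound K s.im)) ∧
    (∀ t : ℝ, Real.exp (-(11 * discBound K t)) ≤
      ‖classGroupLFunction₀ K χ (1 + (1 : ℝ) / 32 + t * I)‖) := by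
  refine ⟨fun σ hσ hσ2 ↦ ?_, fun s hs hs3 ↦ ?_, fun t ↦ ?_⟩
  · have h := re_LSeries_vonMangoldtNorm_le (K := K) (s := (σ : ℂ)) (by simpa using hσ)
      (by simpa using hσ2)
    have h1 : (1 / ((σ : ℂ) - 1)).re = 1 / (σ - 1) := by
      rw [show (σ : ℂ) - 1 = ((σ - 1 : ℝ) : ℂ) by push_cast; ring, ← Complex.ofReal_one,
        ← Complex.ofReal_div, Complex.ofReal_re]
    rwa [h1, Complex.ofReal_im] at h
  · rw [one_mul]
    exact norm_classGroupLFunction₀_le_exp_discBound hχ (by linarith) hs3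
  · simpa using exp_neg_discBound_le_norm_classGroupLFunction₀ hχ t

/-- **The datum for `χ² ≠ 1`** (`pole = false`): `DegreeUniformTwistedZFRData` for `F = L₀(·, χ)`
with the size functional `M_K` and the ABSOLUTE parameters `η = 1`, `G = 1`, `G' = 11`,
`K₀ = 77760`, `C₂ = 77761`; `Λ₀ = Λ_K`, `Λ₁ = Λ_χ`, `Λ₂ = Λ_{χ²}`.
[cite: ThornerZaman2019, Theorem 3.1] -/
theorem degreeUniformTwistedZFRData_classGroupLFunction₀_of_ne {χ : ClassGroup (𝓞 K) →* ℂˣ}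
    (h2 : χ * χ ≠ 1) :
    DegreeUniformTwistedZFRData 1 1 11 77760 77761 false (discBound K)
      (vonMangoldtNorm K) (twistVonMangoldt K (classGroupCharIdealHom χ))
      (twistVonMangoldt K (classGroupCharIdealHom (χ * χ))) (classGroupLFunction₀ K χ) := by
  have hχ : χ ≠ 1 := fun h ↦ h2 (by rw [h]; exact mul_one (1 : ClassGroup (𝓞 K) →* ℂˣ))
  obtain ⟨h0, hgr, hlow⟩ := degreeUniformZFRData_common (K := K) hχ
  exact {
    eta_pos := one_pos
    eta_le_one := le_rfl
    G_nonneg := zero_le_one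
    G'_nonneg := by norm_num
    K₀_nonneg := by norm_num
    C₂_nonneg := by norm_num
    one_le_ell := one_le_discBound K
    ell_two_mul_le := discBound_two_mul_le
    ell_zero_le := discBound_zero_le_discBound
    ell_le_of_near := discBound_le_two_mul_of_near
    nonneg := vonMangoldtNorm_nonneg
    summable := fun s hs ↦ LSeriesSummable_vonMangoldtNorm hs
    re_LSeries₀_le := h0
    norm_le₁ := norm_twistVonMangoldt_le (norm_classGroupCharIdealHom_le χ)
    norm_le₂ := norm_twistVonMangoldt_le (norm_classGroupCharIdealHom_le (χ * χ))
    three_four_one := fun σ hσ t ↦ three_four_one_classGroupChar K χ hσ t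
    differentiableOn := (differentiable_classGroupLFunction₀ χ).differentiableOn
    ne_zero := fun s hs ↦ by
      have hs1 : s ≠ 1 := fun h ↦ by rw [h, one_re] at hs; exact lt_irrefl _ hs
      rw [classGroupLFunction₀_eq χ hs1 hχ]
      exact classGroupLFunction_ne_zero_of_one_lt_re K χ hs
    logDeriv_eq := fun s hs ↦ logDeriv_classGroupLFunction₀_eq hχ hs
    growth := fun s hs hs3 ↦ hgr s hs hs3
    lower := fun t ↦ by simpa using hlow t
    re_LSeries₂_le := fun s hs hs2 ↦ by
      have h := re_LSeries_twistVonMangoldt_le (K := K) h2 hs hs2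
      have hM := one_le_discBound K s.im
      simp only [Bool.false_eq_true, ↓reduceIte, zero_add]
      linarith
    reflect := fun h ↦ absurd h Bool.false_ne_true }

/-- **The datum for a real character** (`χ² = 1`, `χ ≠ 1`, `pole = true`): as above with
`Λ₂ = Λ_{χ²} = Λ_K`, the companion bound being the Stark-type bound for `−ζ_K'/ζ_K`, and the
reflection symmetry from `conj L₀(conj s, χ) = L₀(s, χ)`. [cite: ThornerZaman2019, Theorem 3.1] -/
theorem degreeUniformTwistedZFRData_classGroupLFunction₀_of_eq {χ : ClassGroup (𝓞 K) →* ℂˣ}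
    (hχ : χ ≠ 1) (h2 : χ * χ = 1) :
    DegreeUniformTwistedZFRData 1 1 11 77760 77761 true (discBound K)
      (vonMangoldtNorm K) (twistVonMangoldt K (classGroupCharIdealHom χ))
      (twistVonMangoldt K (classGroupCharIdealHom (χ * χ))) (classGroupLFunction₀ K χ) := by
  obtain ⟨h0, hgr, hlow⟩ := degreeUniformZFRData_common (K := K) hχ
  exact {
    eta_pos := one_pos
    eta_le_one := le_rfl
    G_nonneg := zero_le_one
    G'_nonneg := by norm_num
    K₀_nonneg := by norm_num
    C₂_nonneg := by norm_num
    one_le_ell := one_le_discBound K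
    ell_two_mul_le := discBound_two_mul_le
    ell_zero_le := discBound_zero_le_discBound
    ell_le_of_near := discBound_le_two_mul_of_near
    nonneg := vonMangoldtNorm_nonneg
    summable := fun s hs ↦ LSeriesSummable_vonMangoldtNorm hs
    re_LSeries₀_le := h0
    norm_le₁ := norm_twistVonMangoldt_le (norm_classGroupCharIdealHom_le χ)
    norm_le₂ := norm_twistVonMangoldt_le (norm_classGroupCharIdealHom_le (χ * χ))
    three_four_one := fun σ hσ t ↦ three_four_one_classGroupChar K χ hσ t
    differentiableOn := (differentiable_classGroupLFunction₀ χ).differentiableOn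
    ne_zero := fun s hs ↦ by
      have hs1 : s ≠ 1 := fun h ↦ by rw [h, one_re] at hs; exact lt_irrefl _ hs
      rw [classGroupLFunction₀_eq χ hs1 hχ]
      exact classGroupLFunction_ne_zero_of_one_lt_re K χ hs
    logDeriv_eq := fun s hs ↦ logDeriv_classGroupLFunction₀_eq hχ hs
    growth := fun s hs hs3 ↦ hgr s hs hs3
    lower := fun t ↦ by simpa using hlow t
    re_LSeries₂_le := fun s hs hs2 ↦ by
      have hΛ : twistVonMangoldt K (classGroupCharIdealHom (χ * χ)) =
          fun m ↦ (vonMangoldtNorm K m : ℂ) := by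
        rw [h2, classGroupCharIdealHom_one]
        funext m
        exact twistVonMangoldt_trivialChar m
      rw [hΛ]
      have h := re_LSeries_vonMangoldtNorm_le (K := K) hs hs2
      have hM := discBound_nonneg K s.im
      simp only [↓reduceIte]
      linarith
    reflect := fun _ ρ _ hρ ↦ classGroupLFunction₀_conj_eq_zero hχ h2 hρ }

end Datum

/-! ### The zero-free region with an absolute constant -/

/-- **Zero-free region for class group `L`-functions with an ABSOLUTE constant**
([ThornerZaman2019, Theorem 3.1] for `χ ≠ 1`; Lagarias–Odlyzko Lemma 8.1): there is an absolute
`c > 0` such that for EVERY number field `K`, every class group character `χ ≠ 1` of `K` and every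
zero `ρ` of the entire function `L₀(s, χ)` (= `L(s, χ)` off `s = 1`) with
`Re ρ > 1 − c/M_K(Im ρ)`, `M_K(t) = log|d_K| + 3n_K + (n_K + 1) log(|t| + 7)`, the character is
real (`χ² = 1`) and the zero is real (`Im ρ = 0`). [cite: ThornerZaman2019, Theorem 3.1] -/
theorem exists_zeroFree_classGroupLFunction₀_absolute :
    ∃ c : ℝ, 0 < c ∧ ∀ (K : Type) [Field K] [NumberField K],
      ∀ χ : ClassGroup (𝓞 K) →* ℂˣ, χ ≠ 1 → ∀ ρ : ℂ, classGroupLFunction₀ K χ ρ = 0 →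
        1 - c / discBound K ρ.im < ρ.re → χ * χ = 1 ∧ ρ.im = 0 := by
  obtain ⟨c, hc, hzf⟩ := DegreeUniformTwistedZFRData.exists_zeroFree_const
    (η := 1) (G := 1) (G' := 11) (K₀ := 77760) (C₂ := 77761)
    one_pos zero_le_one (by norm_num) (by norm_num) (by norm_num)
  refine ⟨c, hc, fun K _ _ χ hχ ρ hρ hregion ↦ ?_⟩
  by_cases h2 : χ * χ = 1
  · have hdat := degreeUniformTwistedZFRData_classGroupLFunction₀_of_eq hχ h2
    exact ⟨h2, (hzf _ _ _ _ _ _ hdat ρ hρ hregion).2⟩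
  · have hdat := degreeUniformTwistedZFRData_classGroupLFunction₀_of_ne h2
    have := (hzf _ _ _ _ _ _ hdat ρ hρ hregion).1
    exact absurd this Bool.false_ne_true

/-- The same for `L(s, χ)` itself (`s ≠ 1`). [cite: ThornerZaman2019, Theorem 3.1] -/
theorem exists_zeroFree_classGroupLFunction_absolute :
    ∃ c : ℝ, 0 < c ∧ ∀ (K : Type) [Field K] [NumberField K],
      ∀ χ : ClassGroup (𝓞 K) →* ℂˣ, χ ≠ 1 → ∀ ρ : ℂ, ρ ≠ 1 → classGroupLFunction K χ ρ = 0 →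
        1 - c / discBound K ρ.im < ρ.re → χ * χ = 1 ∧ ρ.im = 0 := by
  obtain ⟨c, hc, h⟩ := exists_zeroFree_classGroupLFunction₀_absolute
  refine ⟨c, hc, fun K _ _ χ hχ ρ hρ1 hρ hregion ↦ h K χ hχ ρ ?_ hregion⟩
  rw [classGroupLFunction₀_eq χ hρ1 hχ, hρ]

end Literature.NumberTheory.LFunctions.NumberField
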